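import Mathlib.Topology.MetricSpace.HausdorffDistance
import Literature.Probability.RandomPlanarGeometry.UnbasedLoops
import HarnessLib

/-!
# The space of unbased oriented loops

Second step (after `UnbasedLoops`) towards Duminil-Copin–Kozlowski–Krachun–Manolescu–Oulamara's
printed metric `d_CN` (arXiv:2012.11672v2, §1.2, eq. (1)): the unbased oriented
reparametrisation distance `Curve.loopDist` descends to curve classes and makes the loop classes
into a pseudo-metric space whose metric quotient is the space of *unbased oriented loops* —
closed curves modulo orientation-preserving reparametrisation of the circle (DKKMO,
arXiv:2012.11672v2, eq. (1), "parametrizations of the loops by `S¹`", with orientation kept: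
DKKMO compare loops "typed" as exterior boundaries of primal / dual clusters, the display above
eq. (1), which for interface loops is the orientation; Camia–Newman's own distance, CMP 268
(2006), §2.2 (2), is the *based* one of the prelude).

* `CurveClass.loopDist` — `Curve.loopDist` on classes (`SeparationQuotient.lift₂`), `≤ dist`,
  symmetric and sub-additive on loop classes.
* `BasedLoop E := {c : CurveClass E // c.IsLoop}` as a type synonym carrying the pseudo-metric
  `loopDist` (not the based metric); `UnbasedLoop E := SeparationQuotient (BasedLoop E)`, a metric
  space; `UnbasedLoop.mk`, `mk_eq_mk`.
* `UnbasedLoop.range` (the trace; well defined), `isCompact_range`, and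
  `hausdorffDist_range_le_dist`: traces of unbased loops at distance `d` are at Hausdorff distance
  `≤ d` (every point of one trace is within `loopDist` of the other,
  `Curve.infDist_range_le_loopDist`).

## References

* F. Camia, C. M. Newman, Comm. Math. Phys. 268 (2006), §2.2 (the based distance (2), for contrast).
* H. Duminil-Copin, K. K. Kozlowski, D. Krachun, I. Manolescu, M. Oulamara, arXiv:2012.11672v2
  (2026), §1.2, eq. (1).
* M. Aizenman, A. Burchard, Duke Math. J. 99 (1999), §2.1.
-/

noncomputable section

open Set
open scoped unitInterval

namespace Literature.Probability.RandomPlanarGeometry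

namespace Curve

variable {E : Type*} [MetricSpace E]

/-- Curves at reparametrisation distance `0` are loops simultaneously. [folklore] -/
theorem isLoop_iff_of_reparamDist_eq_zero {β β' : Curve E} (h : reparamDist β β' = 0) :
    β.IsLoop ↔ β'.IsLoop := by
  rw [Curve.isLoop_iff, Curve.isLoop_iff, source_eq_of_dist_eq_zero h, target_eq_of_dist_eq_zero h]

/-- For a non-loop second argument `loopDist` is the based distance (junk `shift`). [folklore] -/
theorem loopDist_of_not_isLoop (α : Curve E) {β : Curve E} (hβ : ¬ β.IsLoop) :
    loopDist α β = reparamDist α β := by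
  refine le_antisymm (loopDist_le_reparamDist α β) (le_ciInf fun b ↦ ?_)
  rw [shift_of_not_isLoop hβ]

/-- `loopDist` is compatible with the reparametrisation pseudo-metric in the second argument,
with no loop hypothesis. [folklore] -/
theorem loopDist_eq_of_reparamDist_eq_zero_right' (α : Curve E) {β β' : Curve E}
    (h : reparamDist β β' = 0) : loopDist α β = loopDist α β' := by
  by_cases hβ : β.IsLoop
  · exact loopDist_eq_of_reparamDist_eq_zero_right α hβ ((isLoop_iff_of_reparamDist_eq_zero h).1 hβ) h
  · have hβ' : ¬ β'.IsLoop := fun h' => hβ ((isLoop_iff_of_reparamDist_eq_zero h).2 h')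
    rw [loopDist_of_not_isLoop α hβ, loopDist_of_not_isLoop α hβ']
    refine le_antisymm ?_ ?_
    · have := reparamDist_triangle α β' β
      rw [reparamDist_comm β' β, h, add_zero] at this; exact this
    · have := reparamDist_triangle α β β'
      rw [h, add_zero] at this; exact this

end Curve

namespace CurveClass

variable {E : Type*} [MetricSpace E]

/-- The **unbased oriented distance** on curve classes: `Curve.loopDist` descends to the
separation quotient `CurveClass E` (it is compatible with the reparametrisation pseudo-metric in
both arguments). On loop classes it is a pseudo-metric whose zero set identifies the based
representatives of one unbased oriented loop. (DKKMO, arXiv:2012.11672v2, eq. (1).) [cite: arXiv201211672v2, eq. (1)] -/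
def loopDist : CurveClass E → CurveClass E → ℝ :=
  SeparationQuotient.lift₂ Curve.loopDist fun a b c d hac hbd ↦ by
    rw [Curve.loopDist_eq_of_reparamDist_eq_zero b (Metric.inseparable_iff.1 hac),
      Curve.loopDist_eq_of_reparamDist_eq_zero_right' c (Metric.inseparable_iff.1 hbd)]

/-- `CurveClass.loopDist` on classes of curves. [folklore] -/
@[simp] theorem loopDist_mk (α β : Curve E) : loopDist (mk α) (mk β) = Curve.loopDist α β := rfl

/-- The unbased distance of classes is at most their (based) distance. [cite: arXiv201211672v2, eq. (1)] -/
theorem loopDist_le_dist (c₁ c₂ : CurveClass E) : loopDist c₁ c₂ ≤ dist c₁ c₂ := by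
  obtain ⟨α, rfl⟩ := surjective_mk c₁
  obtain ⟨β, rfl⟩ := surjective_mk c₂
  exact Curve.loopDist_le_reparamDist α β

/-- `CurveClass.loopDist` is nonnegative. [folklore] -/
theorem loopDist_nonneg (c₁ c₂ : CurveClass E) : 0 ≤ loopDist c₁ c₂ := by
  obtain ⟨α, rfl⟩ := surjective_mk c₁
  obtain ⟨β, rfl⟩ := surjective_mk c₂
  exact Curve.loopDist_nonneg α β

/-- `CurveClass.loopDist c c = 0`. [folklore] -/
theorem loopDist_self (c : CurveClass E) : loopDist c c = 0 := by
  obtain ⟨α, rfl⟩ := surjective_mk c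
  exact Curve.loopDist_self α

/-- Symmetry of `CurveClass.loopDist` on loop classes. [cite: arXiv201211672v2, eq. (1)] -/
theorem loopDist_comm {c₁ c₂ : CurveClass E} (h₁ : c₁.IsLoop) (h₂ : c₂.IsLoop) :
    loopDist c₁ c₂ = loopDist c₂ c₁ := by
  obtain ⟨α, rfl⟩ := surjective_mk c₁
  obtain ⟨β, rfl⟩ := surjective_mk c₂
  exact Curve.loopDist_comm h₁ h₂

/-- Triangle inequality for `CurveClass.loopDist` on loop classes. [cite: arXiv201211672v2, eq. (1)] -/
theorem loopDist_triangle (c₁ : CurveClass E) {c₂ c₃ : CurveClass E} (h₂ : c₂.IsLoop)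
    (h₃ : c₃.IsLoop) : loopDist c₁ c₃ ≤ loopDist c₁ c₂ + loopDist c₂ c₃ := by
  obtain ⟨α, rfl⟩ := surjective_mk c₁
  obtain ⟨β, rfl⟩ := surjective_mk c₂
  obtain ⟨γ, rfl⟩ := surjective_mk c₃
  exact Curve.loopDist_triangle α h₂ h₃

end CurveClass

end Literature.Probability.RandomPlanarGeometry


namespace Literature.Probability.RandomPlanarGeometry

namespace Curve

variable {E : Type*} [TopologicalSpace E]

/-- A change of base point does not change the trace. [folklore] -/
theorem range_shift (γ : Curve E) (a : ℝ) : (γ.shift a).range = γ.range := by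
  by_cases hγ : γ.IsLoop
  · ext x
    simp only [Curve.mem_range]
    constructor
    · rintro ⟨t, rfl⟩
      exact ⟨_, by rw [shift_apply hγ, loopMap_coe_eq]⟩
    · rintro ⟨t, rfl⟩
      refine ⟨⟨Int.fract ((t : ℝ) - a), Int.fract_nonneg _, (Int.fract_lt_one _).le⟩, ?_⟩
      rw [shift_apply hγ, loopMap_coe_eq]
      apply apply_eq_of_fract_eq hγ
      have hf : Int.fract (Int.fract ((t : ℝ) - a) + a) = Int.fract (t : ℝ) := by
        rw [Int.fract_eq_fract]
        refine ⟨-⌊(t : ℝ) - a⌋, ?_⟩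
        rw [Int.cast_neg, ← Int.self_sub_floor]
        ring
      simp only [Int.fract_fract]
      exact hf
  · rw [shift_of_not_isLoop hγ]

end Curve

/-! ### Based loops with the unbased distance, and unbased loops -/

/-- The type of based loop classes (loops of `CurveClass E`), as a type synonym carrying the
*unbased* oriented distance `CurveClass.loopDist` (and not the based metric of `CurveClass E`).
(DKKMO, arXiv:2012.11672v2, eq. (1).) [cite: arXiv201211672v2, eq. (1)] -/
def BasedLoop (E : Type*) [MetricSpace E] : Type _ := {c : CurveClass E // c.IsLoop}

namespace BasedLoop

variable {E : Type*} [MetricSpace E]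

/-- The underlying curve class of a based loop. [folklore] -/
def toCurveClass (ℓ : BasedLoop E) : CurveClass E := ℓ.1

/-- A based loop is a loop. [folklore] -/
theorem isLoop (ℓ : BasedLoop E) : ℓ.toCurveClass.IsLoop := ℓ.2

/-- A based loop from a loop class. [folklore] -/
def mk (c : CurveClass E) (hc : c.IsLoop) : BasedLoop E := ⟨c, hc⟩

/-- `toCurveClass` of `mk`. [folklore] -/
@[simp] theorem toCurveClass_mk (c : CurveClass E) (hc : c.IsLoop) : (mk c hc).toCurveClass = c := rfl

/-- Based loops carry the unbased oriented reparametrisation pseudo-distance `CurveClass.loopDist`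
(DKKMO eq. (1)). [cite: arXiv201211672v2, eq. (1)] -/
instance : PseudoMetricSpace (BasedLoop E) where
  dist ℓ ℓ' := CurveClass.loopDist ℓ.1 ℓ'.1
  dist_self ℓ := CurveClass.loopDist_self ℓ.1
  dist_comm ℓ ℓ' := CurveClass.loopDist_comm ℓ.2 ℓ'.2
  dist_triangle ℓ ℓ' ℓ'' := CurveClass.loopDist_triangle ℓ.1 ℓ'.2 ℓ''.2

/-- Unfolding the distance of based loops. [folklore] -/
theorem dist_def (ℓ ℓ' : BasedLoop E) : dist ℓ ℓ' = CurveClass.loopDist ℓ.toCurveClass ℓ'.toCurveClass := rfl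

/-- The unbased distance of based loops is at most their based distance. [folklore] -/
theorem dist_le_dist_toCurveClass (ℓ ℓ' : BasedLoop E) :
    dist ℓ ℓ' ≤ dist ℓ.toCurveClass ℓ'.toCurveClass :=
  CurveClass.loopDist_le_dist _ _

end BasedLoop

/-- **Unbased (oriented) loops**: based loop classes modulo the unbased distance — closed curves
up to orientation-preserving reparametrisation of the circle (DKKMO, arXiv:2012.11672v2,
eq. (1), oriented version). A metric space. [cite: arXiv201211672v2, eq. (1)] -/
abbrev UnbasedLoop (E : Type*) [MetricSpace E] : Type _ := SeparationQuotient (BasedLoop E)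

namespace UnbasedLoop

variable {E : Type*} [MetricSpace E]

/-- The unbased loop of a based loop class. [folklore] -/
def mk (ℓ : BasedLoop E) : UnbasedLoop E := SeparationQuotient.mk ℓ

/-- Every unbased loop has a based representative. [folklore] -/
theorem mk_surjective : Function.Surjective (mk : BasedLoop E → UnbasedLoop E) :=
  SeparationQuotient.surjective_mk

/-- The distance of unbased loops is the unbased distance of representatives. [folklore] -/
@[simp] theorem dist_mk_mk (ℓ ℓ' : BasedLoop E) : dist (mk ℓ) (mk ℓ') = dist ℓ ℓ' := rfl

/-- Two based loops give the same unbased loop iff their unbased distance vanishes. [folklore] -/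
theorem mk_eq_mk {ℓ ℓ' : BasedLoop E} : mk ℓ = mk ℓ' ↔ dist ℓ ℓ' = 0 := by
  rw [mk, mk, SeparationQuotient.mk_eq_mk, Metric.inseparable_iff]

/-- Every point of the trace of `α` is at distance `≤ loopDist α β` from the trace of the loop `β`
(the unbased distance dominates the one-sided Hausdorff distance of traces). [folklore] -/
theorem _root_.Literature.Probability.RandomPlanarGeometry.Curve.infDist_range_le_loopDist (α β : Curve E) (t : I) :
    Metric.infDist (α t) β.range ≤ Curve.loopDist α β := by
  refine le_ciInf fun b ↦ ?_
  rw [← Curve.range_shift β b]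
  exact Curve.infDist_range_le α (β.shift b) t

/-- Loops at unbased distance `0` have the same trace. [folklore] -/
theorem _root_.Literature.Probability.RandomPlanarGeometry.BasedLoop.range_eq_of_dist_eq_zero {ℓ ℓ' : BasedLoop E} (h : dist ℓ ℓ' = 0) :
    ℓ.toCurveClass.range = ℓ'.toCurveClass.range := by
  suffices key : ∀ {ℓ ℓ' : BasedLoop E}, dist ℓ ℓ' = 0 → ℓ.toCurveClass.range ⊆ ℓ'.toCurveClass.range from
    Set.Subset.antisymm (key h) (key (by rwa [dist_comm]))
  rintro ⟨c, hc⟩ ⟨c', hc'⟩ h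
  obtain ⟨α, rfl⟩ := CurveClass.surjective_mk c
  obtain ⟨β, rfl⟩ := CurveClass.surjective_mk c'
  change Curve.loopDist α β = 0 at h
  change (CurveClass.mk α).range ⊆ (CurveClass.mk β).range
  rw [CurveClass.range_mk, CurveClass.range_mk]
  rintro _ ⟨t, rfl⟩
  have h0 : Metric.infDist (α t) β.range = 0 :=
    le_antisymm (h ▸ Curve.infDist_range_le_loopDist α β t) Metric.infDist_nonneg
  have := (Metric.mem_closure_iff_infDist_zero β.range_nonempty).2 h0
  rwa [β.isCompact_range.isClosed.closure_eq] at this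

/-- The trace of an unbased loop (well defined: loops at unbased distance `0` have the same
compact trace). [folklore] -/
def range : UnbasedLoop E → Set E :=
  SeparationQuotient.lift (fun ℓ : BasedLoop E => ℓ.toCurveClass.range) fun _ _ h ↦
    BasedLoop.range_eq_of_dist_eq_zero (Metric.inseparable_iff.1 h)

end UnbasedLoop

end Literature.Probability.RandomPlanarGeometry

namespace Literature.Probability.RandomPlanarGeometry.UnbasedLoop

variable {E : Type*} [MetricSpace E]

/-- The trace of the unbased loop of a based loop. [folklore] -/
@[simp] theorem range_mk (ℓ : BasedLoop E) : (mk ℓ).range = ℓ.toCurveClass.range := rfl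

/-- The trace of an unbased loop is compact. [folklore] -/
theorem isCompact_range (u : UnbasedLoop E) : IsCompact u.range := by
  obtain ⟨ℓ, rfl⟩ := mk_surjective u
  exact ℓ.toCurveClass.isCompact_range

/-- The trace of an unbased loop is nonempty. [folklore] -/
theorem range_nonempty (u : UnbasedLoop E) : u.range.Nonempty := by
  obtain ⟨ℓ, rfl⟩ := mk_surjective u
  exact ℓ.toCurveClass.range_nonempty

/-- Every point of the trace of `u` is within `dist u u'` of the trace of `u'`: traces of close
unbased loops are Hausdorff-close. [folklore] -/
theorem infDist_range_le_dist (u u' : UnbasedLoop E) {x : E} (hx : x ∈ u.range) :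
    Metric.infDist x u'.range ≤ dist u u' := by
  obtain ⟨⟨c, hc⟩, rfl⟩ := mk_surjective u
  obtain ⟨⟨c', hc'⟩, rfl⟩ := mk_surjective u'
  obtain ⟨α, rfl⟩ := CurveClass.surjective_mk c
  obtain ⟨β, rfl⟩ := CurveClass.surjective_mk c'
  change x ∈ (CurveClass.mk α).range at hx
  rw [CurveClass.range_mk] at hx
  obtain ⟨t, rfl⟩ := hx
  change Metric.infDist (α t) (CurveClass.mk β).range ≤ Curve.loopDist α β
  rw [CurveClass.range_mk]
  exact Curve.infDist_range_le_loopDist α β t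

/-- Traces of unbased loops at distance `d` are at Hausdorff distance `≤ d` (the loop distance
dominates the Hausdorff distance of traces). [folklore] -/
theorem hausdorffDist_range_le_dist (u u' : UnbasedLoop E) :
    Metric.hausdorffDist u.range u'.range ≤ dist u u' := by
  apply Metric.hausdorffDist_le_of_infDist dist_nonneg
  · exact fun x hx => infDist_range_le_dist u u' hx
  · intro x hx
    rw [dist_comm]
    exact infDist_range_le_dist u' u hx

end Literature.Probability.RandomPlanarGeometry.UnbasedLoop

end
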